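import Summits.ValiantsHypothesis.ValiantsHypothesis.Theorems.GrenetZeonDualUnipotentThreeHalvesLongMassNilSpaceWordsOneLetter
import Literature.LinearAlgebra.Matrix.UnipotentExpShear

/-!
# `GrenetZeon.DualUnipotentThreeHalves` (stmt-ValiantsHypothesis-24318), line `slow_core`, stub (c) `SlowCore.LongMassSlowLawInv`:
# THE FIRST DEEP-MODE CONDITION IS GENUINELY MIXED — a `4 × 4` witness

✓ `window_order_sub_three_iff_powDeriv` (order `H − 3` in closed form) asks, beyond the pure index condition `w^{H−2} = 0`, for the
criticality condition `Σ_{i+j=H−2} w^i · A · w^j = 0` (`A ∈ V`).  This file certifies that the second condition is NOT a consequence of the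
first, already inside the free triangular algebra: with `w = E₀₁ + E₂₃`, `A = E₁₂ ∈ 𝔫₄` one has `w² = 0` but `w·A·w = E₀₃ ≠ 0`.

* `exists_pure_not_critical` — there are a nil space `V ≤ M₄(ℂ)` of uniform index `≤ 4` (here `V = span{E₀₁ + E₂₃, E₁₂}`) and a line `W ≤ V` with
  `w² = 0` on `W` for which the order-`1` (`= H − 3`) criterion fails;
* ★ `exists_pure_not_window` — hence (✓ `window_order_sub_three_iff_powDeriv`) `(W, 1)` is NOT a window pair of `V` at any window `n ≥ 4`,
  although the index shadow (`w^{k+1} = 0`, ✓ `pow_eq_zero_of_window`) raises no objection: the RelMMS quantity `t_2` UNDER-estimates the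
  (c)-price already for sub-spaces of `𝔫₄`.

HONEST FRAMING.  A calibration example (`--supports stmt-ValiantsHypothesis-24318`); NOT progress on (c) `SlowCore.LongMassSlowLawInv`
(RESEARCH — OPEN); closes no stub; S3, 24318, 8062 and `VP ≠ VNP` are NOT proved.  Def-free, no named facts, no sorry.
-/

set_option linter.dupNamespace false
set_option autoImplicit false

noncomputable section

namespace Summit.ValiantsHypothesis.ValiantsHypothesis.Theorems.GrenetZeon.NilSpaceWords

open MvPolynomial Matrix
open scoped BigOperators
open Literature.LinearAlgebra.Matrix (IsStrictUpper)

/-- `E₀₁ + E₂₃` and `E₁₂` are strictly upper triangular, hence so is their span, a nil space of uniform index `≤ 4`. -/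
theorem span_pair_pow_four_eq_zero :
    ∀ X ∈ Submodule.span ℂ ({Matrix.single (0 : Fin 4) (1 : Fin 4) (1 : ℂ) + Matrix.single 2 3 1, Matrix.single 1 2 1} :
      Set (Matrix (Fin 4) (Fin 4) ℂ)), X ^ 4 = 0 := by
  intro X hX
  have hsu : IsStrictUpper X := by
    refine Submodule.span_induction ?_ ?_ ?_ ?_ hX
    · intro Y hY
      rcases hY with rfl | rfl
      · intro i j hij
        rw [Matrix.add_apply, Matrix.single_apply_of_ne, Matrix.single_apply_of_ne, add_zero]
        · rintro ⟨rfl, rfl⟩; exact absurd hij (by decide)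
        · rintro ⟨rfl, rfl⟩; exact absurd hij (by decide)
      · intro i j hij
        rw [Matrix.single_apply_of_ne]
        rintro ⟨rfl, rfl⟩; exact absurd hij (by decide)
    · intro i j _; rfl
    · intro Y Z _ _ hY hZ i j hij
      rw [Matrix.add_apply, hY i j hij, hZ i j hij, add_zero]
    · intro c Y _ hY i j hij
      rw [Matrix.smul_apply, hY i j hij, smul_zero]
  exact hsu.pow_eq_zero

/-- ★ **PURE ⇏ CRITICAL.**  In `V = span{E₀₁ + E₂₃, E₁₂} ≤ 𝔫₄` the line `W = ℂ·(E₀₁ + E₂₃)` is square-zero, yet the order-`1` criterion of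
✓ `window_order_sub_three_iff_powDeriv` (`H = 4`) fails on it: `w·E₁₂·w = E₀₃ ≠ 0`. -/
theorem exists_pure_not_critical :
    ∃ (V W : Submodule ℂ (Matrix (Fin 4) (Fin 4) ℂ)), (∀ X ∈ V, X ^ 4 = 0) ∧ W ≤ V ∧ (∀ w ∈ W, w ^ 2 = 0) ∧
      ¬ (∀ w ∈ W, w ^ (4 - 2) = 0 ∧ ∀ A ∈ V, (∑ i ∈ Finset.range (4 - 1), w ^ i * A * w ^ (4 - 2 - i)) = 0) := by
  set w : Matrix (Fin 4) (Fin 4) ℂ := Matrix.single 0 1 1 + Matrix.single 2 3 1 with hw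
  set A : Matrix (Fin 4) (Fin 4) ℂ := Matrix.single 1 2 1 with hA
  have hw2 : w ^ 2 = 0 := by
    rw [pow_two, hw, Matrix.add_mul, Matrix.mul_add, Matrix.mul_add,
      Matrix.single_mul_single_of_ne (1 : ℂ) 0 1 0 (by decide) 1,
      Matrix.single_mul_single_of_ne (1 : ℂ) 0 1 2 (by decide) 1,
      Matrix.single_mul_single_of_ne (1 : ℂ) 2 3 0 (by decide) 1,
      Matrix.single_mul_single_of_ne (1 : ℂ) 2 3 2 (by decide) 1]
    simp
  have hwAw : w * A * w = Matrix.single 0 3 1 := by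
    rw [hw, hA, Matrix.add_mul, Matrix.add_mul, Matrix.mul_add, Matrix.mul_add,
      Matrix.single_mul_single_same, Matrix.single_mul_single_of_ne (1 : ℂ) 2 3 1 (by decide) 1, Matrix.zero_mul,
      Matrix.single_mul_single_of_ne _ 0 2 0 (by decide) 1, Matrix.single_mul_single_same]
    simp
  refine ⟨Submodule.span ℂ {w, A}, Submodule.span ℂ {w}, span_pair_pow_four_eq_zero,
    Submodule.span_mono (Set.singleton_subset_iff.mpr (Set.mem_insert _ _)), ?_, ?_⟩
  · intro w' hw'
    obtain ⟨c, rfl⟩ := Submodule.mem_span_singleton.mp hw'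
    rw [smul_pow, hw2, smul_zero]
  · intro h
    have h1 := (h w (Submodule.subset_span rfl)).2 A (Submodule.subset_span (Set.mem_insert_of_mem _ rfl))
    -- the sum is `A·w² + w·A·w + w²·A = w·A·w = E₀₃`
    have hsum : (∑ i ∈ Finset.range (4 - 1), w ^ i * A * w ^ (4 - 2 - i)) = w * A * w := by
      rw [show (4 : ℕ) - 1 = 3 from rfl, show (4 : ℕ) - 2 = 2 from rfl,
        Finset.sum_range_succ, Finset.sum_range_succ, Finset.sum_range_succ, Finset.sum_range_zero]
      rw [show 2 - 0 = 2 from rfl, show 2 - 1 = 1 from rfl, show 2 - 2 = 0 from rfl, pow_zero, pow_one, hw2]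
      simp
    rw [hsum, hwAw] at h1
    have h2 := congr_fun (congr_fun h1 0) 3
    rw [Matrix.single_apply_same, Matrix.zero_apply] at h2
    exact one_ne_zero h2

/-- ★ **THE INDEX SHADOW UNDER-ESTIMATES THE PRICE ALREADY IN `𝔫₄`.**  With `V, W` as above and any window `n ≥ 4`: every direction in `W`
is square-zero, but `(W, 1)` is NOT a window pair of `V` (the one-`A` word `w·A·w` has `s`-degree `2`). -/
theorem exists_pure_not_window (n : ℕ) (hn : 4 ≤ n) :
    ∃ (V W : Submodule ℂ (Matrix (Fin 4) (Fin 4) ℂ)), (∀ X ∈ V, X ^ 4 = 0) ∧ W ≤ V ∧ (∀ w ∈ W, w ^ 2 = 0) ∧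
      ¬ (∀ A ∈ V, ∀ w ∈ W, ∀ p : ℕ, p ≤ n - 1 → ∀ i j : Fin 4,
        ((((A.map (C : ℂ → MvPolynomial (Fin 1) ℂ) + (X 0 : MvPolynomial (Fin 1) ℂ) • w.map C) ^ p :
          Matrix (Fin 4) (Fin 4) (MvPolynomial (Fin 1) ℂ)) i j).totalDegree ≤ 1)) := by
  obtain ⟨V, W, hV, hWV, hW2, hnot⟩ := exists_pure_not_critical
  refine ⟨V, W, hV, hWV, hW2, fun hwin => hnot ?_⟩
  have h := (window_order_sub_three_iff_powDeriv V W n hV hWV (by norm_num) hn).mp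
  rw [show (4 : ℕ) - 3 = 1 from rfl] at h
  exact h hwin

end Summit.ValiantsHypothesis.ValiantsHypothesis.Theorems.GrenetZeon.NilSpaceWords

end
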